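import Literature.AlgebraicGeometry.Resolution.HasseSchmidtLocalCriterion
import Literature.AlgebraicGeometry.Resolution.HasseSchmidtEtaleLift
import Mathlib.RingTheory.Unramified.LocalRing
import Mathlib.RingTheory.Kaehler.Basic
import Mathlib.Algebra.MvPolynomial.Derivation
import Mathlib.RingTheory.Jacobson.Ring
import Mathlib.FieldTheory.Separable
import Mathlib.FieldTheory.Perfect
import Mathlib.RingTheory.EssentialFiniteness
import HarnessLib

/-!
# The order criterion by differential operators at closed points of algebras étale over affine space

Topic: `Literature/AlgebraicGeometry/Resolution`. Ring-level form, in every characteristic, of the classical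
criterion at a CLOSED POINT of a smooth variety over a PERFECT field `K`: «for `h ∈ 𝒪_{Z,ξ}` of `𝔪_ξ`-adic order
exactly `N` and every `e ≥ 0`, some `K`-linear differential operator of order `≤ eN` takes `h^e` to a unit; in
particular `Diff^{≤ eN}((h^e)) = 𝒪_{Z,ξ}`» ([VillamayorU2008ReesDiff] §4.1, Remark 4.3; [EGAIV4] §16.8, Thm. 16.11.2).
Smoothness enters through ÉTALE COORDINATES: `𝒪_{Z,ξ} = A_𝔭` with `A` formally étale over `K[X_σ]` and of finite
type over `K` (Mathlib `Algebra.IsStandardSmoothOfRelativeDimension.exists_etale_mvPolynomial` supplies this at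
every point of a smooth scheme), `𝔭` maximal.

* `formallyUnramified_quotient_span_aeval_separable` — `K[X_σ]/(π_i(X_i) : i)` is formally unramified over `K`
  when every `π_i ∈ K[X]` is separable (`dx̄_i = 0` because `π_i′(x̄_i)` is a unit).
* `maximalIdeal_eq_span_aeval_of_formallyUnramified` — for `A` of finite type over `K` and formally unramified over
  `K[X_σ]`, `𝔭 ⊂ A` maximal, `O = A_𝔭`, and separable `π_i ∈ K[X]` with `π_i(x_i) ∈ 𝔭`: `𝔪_O = (π_i(x_i) : i)·O`
  (`O/(π_i(x_i))` is local, essentially of finite type and formally unramified over the field `K`, hence a field: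
  Mathlib `Algebra.FormallyUnramified.map_maximalIdeal`, Stacks 00UW).
* `exists_isDiffOpLE_isUnit_pow_of_etaleCoordinates`, `diffIdeal_span_singleton_pow_eq_top_of_etaleCoordinates` —
  **the criterion**: `K` perfect, `A` formally smooth AND formally unramified over `K[X_σ]`, of finite type over `K`,
  `𝔭` maximal, `O = A_𝔭` with its `K`-structure, `h ∈ 𝔪_O^N ∖ 𝔪_O^{N+1}` ⇒ `∃ D`, `IsDiffOpLE K (eN) D ∧ IsUnit (D (h^e))`,
  and `diffIdeal K (eN) ((h^e)) = ⊤`. Assembly: the Hasse–Schmidt homomorphism extending the Taylor shift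
  (`HasseSchmidtEtaleLift.lean`) localised to `O`; `u_i = π_i(x_i)/π_i′(x_i)` (`π_i` the minimal polynomials of the
  coordinates of the point — separable since `K` is perfect and `A/𝔭` is finite over `K`, Zariski's lemma) generate
  `𝔪_O` and are adapted to first order; conclude by `HasseSchmidtLocalCriterion.lean`.

No claim beyond these ring-level statements; the scheme-level wrapper (stalks of smooth `K`-schemes) and the use by
the Hironaka-2017 adjudication cell (`res-hironaka`, clause p.27 l.24 / typed `U27L24_Z`) live in their own files.
Sources: [EGAIV4] §16.8, 16.11, §17.4–17.6; [Matsumura1987] §25–§27; [VillamayorU2008ReesDiff] §4.1, Remark 4.3;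
[StacksProject] Tag 00UW.
-/

noncomputable section

namespace Literature.AlgebraicGeometry.Resolution

open IsLocalRing MvPowerSeries

universe u v w

section SeparableCoordinates

variable (K : Type u) [Field K] {σ : Type v}

/-- **`K[X_σ]/(π_i(X_i) : i)` is formally unramified over `K` when every `π_i ∈ K[X]` is separable**: in the
quotient `S`, `0 = d(π_i(x̄_i)) = π_i′(x̄_i)·dx̄_i` with `π_i′(x̄_i)` a unit (`π_i` is coprime to `π_i′`), so every
`dx̄_i = 0` and `Ω_{S/K} = 0`. [cite: EGAIV4, Prop. 17.4.1 and Cor. 17.4.2 (unramified ⟺ Ω = 0)]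
[cite: Matsumura1987, §25–§26 (separability and differentials)] -/
theorem formallyUnramified_quotient_span_aeval_separable (π : σ → Polynomial K)
    (hπ : ∀ i, (π i).Separable) :
    Algebra.FormallyUnramified K (MvPolynomial σ K ⧸
      Ideal.span (Set.range fun i => Polynomial.aeval (MvPolynomial.X i : MvPolynomial σ K) (π i))) := by
  set J : Ideal (MvPolynomial σ K) :=
    Ideal.span (Set.range fun i => Polynomial.aeval (MvPolynomial.X i : MvPolynomial σ K) (π i)) with hJ
  -- every `dx̄_i` vanishes in `Ω_{S/K}`
  have hx : ∀ i, KaehlerDifferential.D K (MvPolynomial σ K ⧸ J)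
      (algebraMap (MvPolynomial σ K) (MvPolynomial σ K ⧸ J) (MvPolynomial.X i)) = 0 := by
    intro i
    set xb := algebraMap (MvPolynomial σ K) (MvPolynomial σ K ⧸ J) (MvPolynomial.X i) with hxb
    have hπ0 : Polynomial.aeval xb (π i) = 0 := by
      rw [hxb, Polynomial.aeval_algebraMap_apply, Ideal.Quotient.algebraMap_eq, Ideal.Quotient.eq_zero_iff_mem]
      exact Ideal.subset_span ⟨i, rfl⟩
    have h1 := (KaehlerDifferential.D K (MvPolynomial σ K ⧸ J)).map_aeval (π i) xb
    rw [hπ0, map_zero] at h1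
    -- `π_i` is coprime to `π_i′`, so `π_i′(x̄_i)` has a left inverse `b(x̄_i)`
    obtain ⟨a, b, hab⟩ := hπ i
    have hb : Polynomial.aeval xb b * Polynomial.aeval xb (Polynomial.derivative (π i)) = 1 := by
      have := congrArg (Polynomial.aeval xb) hab
      rwa [map_add, map_mul, map_mul, hπ0, mul_zero, zero_add, map_one] at this
    calc KaehlerDifferential.D K (MvPolynomial σ K ⧸ J) xb
        = (Polynomial.aeval xb b * Polynomial.aeval xb (Polynomial.derivative (π i))) •
            KaehlerDifferential.D K (MvPolynomial σ K ⧸ J) xb := by rw [hb, one_smul]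
      _ = Polynomial.aeval xb b • (Polynomial.aeval xb (Polynomial.derivative (π i)) •
            KaehlerDifferential.D K (MvPolynomial σ K ⧸ J) xb) := mul_smul _ _ _
      _ = 0 := by rw [← h1, smul_zero]
  -- so the universal derivation vanishes on the image of `K[X_σ]`, i.e. everywhere
  have hD : (KaehlerDifferential.D K (MvPolynomial σ K ⧸ J)).compAlgebraMap (MvPolynomial σ K) = 0 := by
    refine MvPolynomial.derivation_ext fun i => ?_
    rw [Derivation.compAlgebraMap_apply, Derivation.zero_apply]
    exact hx i
  have hDzero : ∀ s : MvPolynomial σ K ⧸ J, KaehlerDifferential.D K (MvPolynomial σ K ⧸ J) s = 0 := by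
    intro s
    obtain ⟨r, rfl⟩ := Ideal.Quotient.mk_surjective s
    have := congrArg (fun d : Derivation K (MvPolynomial σ K) (Ω[(MvPolynomial σ K ⧸ J)⁄K]) => d r) hD
    simpa [Derivation.compAlgebraMap_apply] using this
  constructor
  refine subsingleton_of_forall_eq 0 fun x => ?_
  have hx' : x ∈ Submodule.span (MvPolynomial σ K ⧸ J)
      (Set.range (KaehlerDifferential.D K (MvPolynomial σ K ⧸ J))) := by
    rw [KaehlerDifferential.span_range_derivation]; trivial
  have hbot : Submodule.span (MvPolynomial σ K ⧸ J)
      (Set.range (KaehlerDifferential.D K (MvPolynomial σ K ⧸ J))) = ⊥ := by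
    rw [Submodule.span_eq_bot]
    rintro _ ⟨s, rfl⟩
    exact hDzero s
  rw [hbot] at hx'
  exact (Submodule.mem_bot _).mp hx'

end SeparableCoordinates

section EtaleCoordinates

variable (K : Type u) [Field K] {σ : Type v}
  {A : Type w} [CommRing A] [Algebra K A] [Algebra (MvPolynomial σ K) A] [IsScalarTower K (MvPolynomial σ K) A]

/-- **The maximal ideal of an étale-coordinate local ring is generated by the separable equations of the point.**
Let `A` be a `K`-algebra of finite type, formally unramified over `K[X_σ]` (`x_i ∈ A` the images of the variables),
`𝔭 ⊂ A` a maximal ideal and `O = A_𝔭`. If `π_i ∈ K[X]` are SEPARABLE polynomials with `π_i(x_i) ∈ 𝔭` (e.g. the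
minimal polynomials of the coordinates of the point when its residue field is separable over `K`), then
`𝔪_O = (π_i(x_i) : i ∈ σ)·O`. Proof: `O/(π_i(x_i))` is local, essentially of finite type and formally unramified
over the field `K` (tower `K → K[X]/(π_i(X_i)) → O/(π_i(x_i))`), hence a field (Mathlib
`Algebra.FormallyUnramified.map_maximalIdeal`, Stacks 00UW). [cite: EGAIV4, Thm. 17.6.1 and Cor. 17.6.2 (structure of
unramified algebras over a field / at a point)] -/
theorem maximalIdeal_eq_span_aeval_of_formallyUnramified [Algebra.FormallyUnramified (MvPolynomial σ K) A]
    [Algebra.FiniteType K A] (𝔭 : Ideal A) [𝔭.IsMaximal] (O : Type*) [CommRing O] [IsLocalRing O] [Algebra A O]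
    [IsLocalization.AtPrime O 𝔭] (π : σ → Polynomial K) (hπ : ∀ i, (π i).Separable)
    (hπ𝔭 : ∀ i, Polynomial.aeval (algebraMap (MvPolynomial σ K) A (MvPolynomial.X i)) (π i) ∈ 𝔭) :
    maximalIdeal O = Ideal.span (Set.range fun i =>
      algebraMap A O (Polynomial.aeval (algebraMap (MvPolynomial σ K) A (MvPolynomial.X i)) (π i))) := by
  set J : Ideal (MvPolynomial σ K) :=
    Ideal.span (Set.range fun i => Polynomial.aeval (MvPolynomial.X i : MvPolynomial σ K) (π i)) with hJ
  set JO : Ideal O := Ideal.span (Set.range fun i =>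
      algebraMap A O (Polynomial.aeval (algebraMap (MvPolynomial σ K) A (MvPolynomial.X i)) (π i))) with hJO
  have hJO_le : JO ≤ maximalIdeal O := by
    rw [hJO, Ideal.span_le]
    rintro _ ⟨i, rfl⟩
    exact (IsLocalization.AtPrime.to_map_mem_maximal_iff O 𝔭 _).mpr (hπ𝔭 i)
  haveI : Nontrivial (O ⧸ JO) :=
    Ideal.Quotient.nontrivial_iff.mpr (ne_top_of_le_ne_top (maximalIdeal.isMaximal O).ne_top hJO_le)
  haveI : IsLocalRing (O ⧸ JO) := .of_surjective' _ Ideal.Quotient.mk_surjective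
  -- algebra structures along `K → K[X] → A → O → O ⧸ JO`
  letI : Algebra (MvPolynomial σ K) O := ((algebraMap A O).comp (algebraMap (MvPolynomial σ K) A)).toAlgebra
  haveI : IsScalarTower (MvPolynomial σ K) A O := IsScalarTower.of_algebraMap_eq fun _ => rfl
  letI : Algebra K O := ((algebraMap A O).comp (algebraMap K A)).toAlgebra
  haveI : IsScalarTower K A O := IsScalarTower.of_algebraMap_eq fun _ => rfl
  haveI : IsScalarTower K (MvPolynomial σ K) O := IsScalarTower.of_algebraMap_eq fun c => by
    show (algebraMap A O) (algebraMap K A c) = (algebraMap A O) (algebraMap (MvPolynomial σ K) A _)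
    rw [IsScalarTower.algebraMap_apply K (MvPolynomial σ K) A c]
  -- `J` maps into `JO`, so `K[X] ⧸ J → O ⧸ JO`
  have hJle : J ≤ JO.comap (algebraMap (MvPolynomial σ K) O) := by
    rw [hJ, Ideal.span_le]
    rintro _ ⟨i, rfl⟩
    rw [SetLike.mem_coe, Ideal.mem_comap]
    refine Ideal.subset_span ⟨i, ?_⟩
    show algebraMap A O (Polynomial.aeval (algebraMap (MvPolynomial σ K) A (MvPolynomial.X i)) (π i)) =
      algebraMap (MvPolynomial σ K) O (Polynomial.aeval (MvPolynomial.X i : MvPolynomial σ K) (π i))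
    rw [Polynomial.aeval_algebraMap_apply, IsScalarTower.algebraMap_apply (MvPolynomial σ K) A O]
  letI : Algebra (MvPolynomial σ K ⧸ J) (O ⧸ JO) :=
    (Ideal.quotientMap JO (algebraMap (MvPolynomial σ K) O) hJle).toAlgebra
  haveI : IsScalarTower (MvPolynomial σ K) (MvPolynomial σ K ⧸ J) (O ⧸ JO) :=
    IsScalarTower.of_algebraMap_eq (R := MvPolynomial σ K) (S := MvPolynomial σ K ⧸ J) (A := O ⧸ JO) fun r => by
      show _ = Ideal.quotientMap JO (algebraMap (MvPolynomial σ K) O) hJle (Ideal.Quotient.mk J r)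
      rw [Ideal.quotientMap_mk]
      rfl
  haveI : IsScalarTower K (MvPolynomial σ K ⧸ J) (O ⧸ JO) :=
    IsScalarTower.of_algebraMap_eq (R := K) (S := MvPolynomial σ K ⧸ J) (A := O ⧸ JO) fun c => by
      have h1 : algebraMap K (MvPolynomial σ K ⧸ J) c =
          Ideal.Quotient.mk J (algebraMap K (MvPolynomial σ K) c) := rfl
      have h2 : algebraMap K (O ⧸ JO) c = Ideal.Quotient.mk JO (algebraMap K O c) := rfl
      rw [h1, h2]
      show _ = Ideal.quotientMap JO (algebraMap (MvPolynomial σ K) O) hJle (Ideal.Quotient.mk J _)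
      rw [Ideal.quotientMap_mk, ← IsScalarTower.algebraMap_apply K (MvPolynomial σ K) O]
  -- formal unramifiedness of `O ⧸ JO` over `K`
  haveI : Algebra.FormallyUnramified A O := .of_isLocalization (M := 𝔭.primeCompl)
  haveI : Algebra.FormallyUnramified (MvPolynomial σ K) O := .comp (MvPolynomial σ K) A O
  haveI : Algebra.FormallyUnramified (MvPolynomial σ K) (O ⧸ JO) := inferInstance
  haveI : Algebra.FormallyUnramified (MvPolynomial σ K ⧸ J) (O ⧸ JO) :=
    .of_restrictScalars (MvPolynomial σ K) _ _
  haveI : Algebra.FormallyUnramified K (MvPolynomial σ K ⧸ J) :=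
    formallyUnramified_quotient_span_aeval_separable K π hπ
  haveI : Algebra.FormallyUnramified K (O ⧸ JO) := .comp K (MvPolynomial σ K ⧸ J) _
  -- essentially of finite type over `K`
  haveI : Algebra.EssFiniteType K A := inferInstance
  haveI : Algebra.EssFiniteType A O := .of_isLocalization O 𝔭.primeCompl
  haveI : Algebra.EssFiniteType K O := .comp K A O
  haveI : Algebra.FiniteType O (O ⧸ JO) :=
    Algebra.FiniteType.of_surjective (Algebra.ofId O (O ⧸ JO)) Ideal.Quotient.mk_surjective
  haveI : Algebra.EssFiniteType O (O ⧸ JO) := inferInstance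
  haveI : Algebra.EssFiniteType K (O ⧸ JO) := .comp K O _
  haveI : IsLocalHom (algebraMap K (O ⧸ JO)) := ⟨fun a ha => by
    rcases eq_or_ne a 0 with rfl | hne
    · rw [map_zero] at ha
      exact absurd ha not_isUnit_zero
    · exact hne.isUnit⟩
  -- Stacks 00UW: the maximal ideal of `O ⧸ JO` is generated by that of `K`, i.e. is `0`
  have key := Algebra.FormallyUnramified.map_maximalIdeal (R := K) (S := O ⧸ JO)
  rw [show maximalIdeal K = ⊥ from (isField_iff_maximalIdeal_eq.mp (Field.toIsField K)), Ideal.map_bot] at key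
  have hfield : IsField (O ⧸ JO) := isField_iff_maximalIdeal_eq.mpr key.symm
  have hmax : JO.IsMaximal := (Ideal.Quotient.maximal_ideal_iff_isField_quotient JO).mpr hfield
  exact (IsLocalRing.eq_maximalIdeal hmax).symm

end EtaleCoordinates

section Criterion

variable (K : Type u) [Field K] {σ : Type v} [Fintype σ] [DecidableEq σ]
  {A : Type w} [CommRing A] [Algebra K A] [Algebra (MvPolynomial σ K) A] [IsScalarTower K (MvPolynomial σ K) A]

omit [Fintype σ] in
/-- The linear coefficient of `C a + t_i` is `δ_ij`. [folklore] -/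
private theorem coeff_single_C_add_X (a : A) (i j : σ) :
    coeff (Finsupp.single j 1) (MvPowerSeries.C a + MvPowerSeries.X i : MvPowerSeries σ A) =
      if i = j then 1 else 0 := by
  rw [map_add, MvPowerSeries.coeff_C, MvPowerSeries.coeff_X, if_neg (Finsupp.single_ne_zero.mpr one_ne_zero)]
  simp only [zero_add, Finsupp.single_left_inj one_ne_zero, eq_comm]

/-- **Unit form of the order criterion at a closed point of an algebra étale over affine space, every
characteristic.** Let `K` be a PERFECT field, `A` a `K`-algebra of finite type which is formally étale (formally
smooth and formally unramified) over `K[X_σ]`, `𝔭 ⊂ A` a maximal ideal and `O = A_𝔭` with its `K`-structure. If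
`h ∈ 𝔪_O^N ∖ 𝔪_O^{N+1}` then for every `e` some `K`-linear differential operator of `O` of order `≤ eN`
(Grothendieck's sense, `IsDiffOpLE`) takes `h^e` to a UNIT. Proof: the Hasse–Schmidt homomorphism of `A`
extending the Taylor shift (`exists_hasseSchmidt_of_formallySmooth`) localises to `O`; the maximal ideal of `O` is
generated by `π_i(x_i)`, `π_i` the (separable) minimal polynomials of the coordinates of the point
(`maximalIdeal_eq_span_aeval_of_formallyUnramified`), and `u_i = π_i(x_i)/π_i′(x_i)` are adapted to first order
(`D^{[e_j]} u_i ≡ δ_ij`); conclude by `exists_isDiffOpLE_isUnit_pow_of_hasseSchmidt`.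
[cite: VillamayorU2008ReesDiff, §4.1 and Remark 4.3] [cite: EGAIV4, §16.8, Thm. 16.11.2 and §17.6] -/
theorem exists_isDiffOpLE_isUnit_pow_of_etaleCoordinates [PerfectField K]
    [Algebra.FormallySmooth (MvPolynomial σ K) A] [Algebra.FormallyUnramified (MvPolynomial σ K) A]
    [Algebra.FiniteType K A] (𝔭 : Ideal A) [𝔭.IsMaximal] (O : Type*) [CommRing O] [IsLocalRing O] [Algebra A O]
    [IsLocalization.AtPrime O 𝔭] [Algebra K O] [IsScalarTower K A O] {N : ℕ} {h : O}
    (h1 : h ∈ maximalIdeal O ^ N) (h2 : h ∉ maximalIdeal O ^ (N + 1)) (e : ℕ) :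
    ∃ D : O →ₗ[K] O, IsDiffOpLE K (e * N) D ∧ IsUnit (D (h ^ e)) := by
  -- the coordinates `x_i ∈ A`
  set x : σ → A := fun i => algebraMap (MvPolynomial σ K) A (MvPolynomial.X i) with hx
  -- (1) Hasse–Schmidt homomorphism on `A` extending the Taylor shift, and on `O`
  obtain ⟨TA, hTA0, hTAR⟩ := exists_hasseSchmidt_of_formallySmooth K A (σ := σ)
  have hTAK : ∀ c : K, TA (algebraMap K A c) = MvPowerSeries.C (algebraMap K A c) := by
    intro c
    have hc : algebraMap K A c = algebraMap (MvPolynomial σ K) A (MvPolynomial.C c) := by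
      rw [← MvPolynomial.algebraMap_eq, ← IsScalarTower.algebraMap_apply]
    conv_lhs => rw [hc, hTAR, MvPolynomial.eval₂_C]
    rfl
  have hTAx : ∀ i, TA (x i) = MvPowerSeries.C (x i) + MvPowerSeries.X i := by
    intro i
    rw [hx]
    simp only [hTAR, MvPolynomial.eval₂_X]
  obtain ⟨T, hT0, hTK, hTA⟩ := exists_hasseSchmidt_localization TA O 𝔭.primeCompl hTA0 hTAK
  have hTcomp : ∀ (β : σ →₀ ℕ) (a : A),
      hsComponent T β (algebraMap A O a) = algebraMap A O (hsComponent TA β a) := by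
    intro β a
    simp only [hsComponent, hTA, MvPowerSeries.coeff_map]
  -- (2) the residue field and the separable minimal polynomials of the coordinates of the point
  letI := Ideal.Quotient.field 𝔭
  haveI : Algebra.FiniteType K (A ⧸ 𝔭) :=
    Algebra.FiniteType.of_surjective (Ideal.Quotient.mkₐ K 𝔭) (Ideal.Quotient.mkₐ_surjective K 𝔭)
  haveI : Module.Finite K (A ⧸ 𝔭) := finite_of_finite_type_of_isJacobsonRing K (A ⧸ 𝔭)
  set a : σ → A ⧸ 𝔭 := fun i => Ideal.Quotient.mk 𝔭 (x i) with ha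
  have hint : ∀ i, IsIntegral K (a i) := fun i => Algebra.IsIntegral.isIntegral (a i)
  set π : σ → Polynomial K := fun i => minpoly K (a i) with hπ
  have hπsep : ∀ i, (π i).Separable := fun i =>
    PerfectField.separable_of_irreducible (minpoly.irreducible (hint i))
  have hπ𝔭 : ∀ i, Polynomial.aeval (x i) (π i) ∈ 𝔭 := by
    intro i
    rw [← Ideal.Quotient.eq_zero_iff_mem, ← Ideal.Quotient.algebraMap_eq, ← Polynomial.aeval_algebraMap_apply,
      Ideal.Quotient.algebraMap_eq]
    exact minpoly.aeval K (a i)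
  have hπ'𝔭 : ∀ i, Polynomial.aeval (x i) (Polynomial.derivative (π i)) ∉ 𝔭 := by
    intro i hmem
    apply (hπsep i).aeval_derivative_ne_zero (minpoly.aeval K (a i))
    rw [ha]
    simp only
    rw [← Ideal.Quotient.algebraMap_eq, Polynomial.aeval_algebraMap_apply, Ideal.Quotient.algebraMap_eq,
      Ideal.Quotient.eq_zero_iff_mem]
    exact hmem
  -- (3) the maximal ideal of `O` is generated by the `w_i = π_i(x_i)`
  have hmax := maximalIdeal_eq_span_aeval_of_formallyUnramified K 𝔭 O π hπsep hπ𝔭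
  set w : σ → O := fun i => algebraMap A O (Polynomial.aeval (x i) (π i)) with hw
  have hmax' : maximalIdeal O = Ideal.span (Set.range w) := hmax
  have hw𝔪 : ∀ i, w i ∈ maximalIdeal O := fun i => hmax' ▸ Ideal.subset_span ⟨i, rfl⟩
  -- the units `v_i = π_i′(x_i)` and the adapted generators `u_i = w_i v_i⁻¹`
  have hv : ∀ i, IsUnit (algebraMap A O (Polynomial.aeval (x i) (Polynomial.derivative (π i)))) := fun i =>
    IsLocalization.map_units O (⟨_, hπ'𝔭 i⟩ : 𝔭.primeCompl)
  set u : σ → O := fun i => w i * ↑(hv i).unit⁻¹ with hu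
  have hspan : Ideal.span (Set.range u) = maximalIdeal O := by
    rw [hmax']
    apply le_antisymm
    · rw [Ideal.span_le]
      rintro _ ⟨i, rfl⟩
      exact Ideal.mul_mem_right _ _ (Ideal.subset_span ⟨i, rfl⟩)
    · rw [Ideal.span_le]
      rintro _ ⟨i, rfl⟩
      have : w i = u i * ↑(hv i).unit := by
        rw [hu]
        simp only
        rw [mul_assoc, Units.inv_mul, mul_one]
      rw [SetLike.mem_coe, this]
      exact Ideal.mul_mem_right _ _ (Ideal.subset_span ⟨i, rfl⟩)
  -- first-order adaptation `D^{[e_j]} u_i ≡ δ_ij (mod 𝔪)`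
  have hDw : ∀ i j, hsComponent T (Finsupp.single j 1) (w i) =
      algebraMap A O (Polynomial.aeval (x i) (Polynomial.derivative (π i))) * (if i = j then 1 else 0) := by
    intro i j
    rw [hw]
    simp only
    rw [hTcomp, hsComponent_single_aeval TA hTA0 hTAK, map_mul]
    congr 1
    rw [hsComponent, hTAx, coeff_single_C_add_X]
    split_ifs <;> simp
  have hlin : ∀ i j, hsComponent T (Finsupp.single j 1) (u i) - (if i = j then 1 else 0) ∈ maximalIdeal O := by
    intro i j
    rw [hu]
    simp only
    rw [hsComponent_single_mul T hT0, hDw]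
    have hrest : w i * hsComponent T (Finsupp.single j 1) ↑(hv i).unit⁻¹ ∈ maximalIdeal O :=
      Ideal.mul_mem_right _ _ (hw𝔪 i)
    have hvv : algebraMap A O (Polynomial.aeval (x i) (Polynomial.derivative (π i))) * ↑(hv i).unit⁻¹ = 1 :=
      (hv i).mul_val_inv
    split_ifs with hij
    · rw [mul_one, hvv, add_sub_cancel_left]
      exact hrest
    · rw [mul_zero, zero_mul, zero_add, sub_zero]
      exact hrest
  -- (4) conclude by the abstract criterion
  exact exists_isDiffOpLE_isUnit_pow_of_hasseSchmidt T hT0 hTK hspan hlin h1 h2 e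

/-- **`Diff^{≤ eN}_{O/K}((h^e)) = O`** for `h ∈ 𝔪_O^N ∖ 𝔪_O^{N+1}`, in the setting of
`exists_isDiffOpLE_isUnit_pow_of_etaleCoordinates` (the tree's `diffIdeal`). [cite: VillamayorU2008ReesDiff, §4.1 and
Remark 4.3] -/
theorem diffIdeal_span_singleton_pow_eq_top_of_etaleCoordinates [PerfectField K]
    [Algebra.FormallySmooth (MvPolynomial σ K) A] [Algebra.FormallyUnramified (MvPolynomial σ K) A]
    [Algebra.FiniteType K A] (𝔭 : Ideal A) [𝔭.IsMaximal] (O : Type*) [CommRing O] [IsLocalRing O] [Algebra A O]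
    [IsLocalization.AtPrime O 𝔭] [Algebra K O] [IsScalarTower K A O] {N : ℕ} {h : O}
    (h1 : h ∈ maximalIdeal O ^ N) (h2 : h ∉ maximalIdeal O ^ (N + 1)) (e : ℕ) :
    diffIdeal K (e * N) (Ideal.span {h ^ e}) = ⊤ := by
  obtain ⟨D, hD, hunit⟩ := exists_isDiffOpLE_isUnit_pow_of_etaleCoordinates K (σ := σ) 𝔭 O h1 h2 e
  exact Ideal.eq_top_of_isUnit_mem _ (apply_mem_diffIdeal K hD (Ideal.mem_span_singleton_self _)) hunit

end Criterion

end Literature.AlgebraicGeometry.Resolution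

end
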